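/-
Copyright (c) 2026. All rights reserved.
Released under Apache 2.0 license as described in the file LICENSE.
Authors: abc-iut cell, prover seat abc-iut-w5-d144 (gen 6; row «IDRIGID-COVER-INHERITANCE», complement), over the
lineage's `ArchimedeanHolFieldFunctorGeometricCoverInheritance` (p482176) and abc-iut-w6-d003's `IdRigidEpiCoverDescent`.
-/
import Literature.AnabelianGeometry.AbsoluteAnabelian.ArchimedeanHolFieldFunctorGeometricCoverInheritance
import HarnessLib

/-!
# [AbsTopIII] Prop 4.2 (i) at the geometric model: id-rigidity of «objects of `EA` mapping to `𝕏`» is an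
# invariant of the finite-étale COMMENSURABILITY class of `𝕏`

S. Mochizuki, *Topics in Absolute Anabelian Geometry III*, proof of Prop 4.2 (i), kurims p.106 l.11–19 («the full
subcategory of `EA` consisting of objects that map to `X` … [is id-rigid]»; print reduces everything to the
coverings of `X` and to cores, Lemma 4.3). [cite: MochizukiAbsTopIII2015, Proposition 4.2 (i) p.106]

PROOF-ONLY complement (abc-iut cell, campaign-L item R1.2 of the geometric `EA` column; seat abc-iut-w5-d144 gen 6)
to `HolRS.isIdRigid_mapsTo_of_hom` (id-rigidity goes UP along a finite étale `p : 𝕏' → 𝕏`, by Galois descent):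

* `HolRS.isIdRigid_mapsTo_of_hom_of_isIdRigid` — it also goes DOWN: «mapsTo `𝕏'`» id-rigid ⇒ «mapsTo `𝕏`» id-rigid
  (abc-iut-w6-d003's restriction-along-epimorphic-covers `isIdRigid_fullSubcategory_of_epi_cover`: every `𝕎 → 𝕏`
  receives a morphism — an epimorphism of `HolRS` — from a Galois covering of `𝕏` dominating `𝕏'`);
* `HolRS.isIdRigid_mapsTo_iff_of_hom` — hence **«mapsTo `𝕏`» is id-rigid iff «mapsTo `𝕏'`» is**, for every
  morphism `𝕏' → 𝕏` of `HolRS`;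
* `HolRS.isIdRigid_mapsTo_iff_of_common_cover` / `_of_common_quotient` — id-rigidity of «mapsTo `𝕏`» is constant
  on finite-étale COMMENSURABILITY classes (two connected Riemann surfaces with a common finite étale cover, resp.
  a common finite étale quotient);
* zero-hypothesis consequences one step further out than p482176: every `𝕏` COMMENSURABLE with `ℂ ∖ F` (`|F| ≥ 2`),
  with `E ∖ S`, or with a once-punctured elliptic curve — e.g. every free finite quotient of a finite étale cover of
  the tripod — has «objects of `EA` mapping to `𝕏`» id-rigid (`isIdRigid_mapsTo_of_commensurable_planeComplFinite`,
  `…_complexTorus_compl_finite`, `…_of_isPuncturedEllipticCurve`).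

HONEST SCOPE: MODEL side of [AbsTopIII] §4 (model ≠ reconstruction); classical; no definition, no instance, no
Prop-valued fact; support library, not a node; nothing here bears on [IUTchIII] Cor. 3.12; no side taken.

## References

* S. Mochizuki, *Topics in Absolute Anabelian Geometry III*, kurims ms, §0 p.27, proof of Prop 4.2 (i) p.106
  l.11–19, Lemma 4.3 p.106. [MochizukiAbsTopIII2015]
* A. Grothendieck, M. Raynaud, SGA 1, Exp. V §4–§5. [SGA1]
-/

noncomputable section

open CategoryTheory
open Literature.Topology.CoveringSpaces
open Literature.Geometry.Kaehler

namespace Literature.AnabelianGeometry.AbsoluteAnabelian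

namespace HolRS

/-! ### §1 Id-rigidity of «mapsTo `𝕏`» goes down along finite étale covers, hence is invariant -/

/-- **Down along a cover**: for `p : 𝕏' → 𝕏` in `HolRS`, if «objects mapping to `𝕏'`» is id-rigid then so is
«objects mapping to `𝕏`» — every `𝕎 → 𝕏` receives an (epi)morphism from a Galois covering of `𝕏` that dominates
`𝕏'` (`exists_galois_over_hom_hom`), so abc-iut-w6-d003's restriction argument `isIdRigid_fullSubcategory_of_epi_cover`
applies. [cite: MochizukiAbsTopIII2015, Proposition 4.2 (i) p.106] [cite: SGA1, Exp. V §5] -/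
theorem isIdRigid_mapsTo_of_hom_of_isIdRigid {X X' : HolRS} (p : X' ⟶ X)
    (h : IsIdRigid (ObjectProperty.FullSubcategory fun Y : HolRS => Nonempty (Y ⟶ X'))) :
    IsIdRigid (ObjectProperty.FullSubcategory fun Y : HolRS => Nonempty (Y ⟶ X)) := by
  haveI := pathConnectedSpace_carrier X
  haveI := stronglyLocallyContractibleSpace_carrier X
  haveI : GaloisCategory (CovFin X.carrier) := CovFin.galoisCategory
  refine isIdRigid_fullSubcategory_of_epi_cover (P := fun Y : HolRS => Nonempty (Y ⟶ X'))
    (Q := fun Y : HolRS => Nonempty (Y ⟶ X)) (fun _ hY => hY.elim fun f => ⟨f ≫ p⟩) h fun W hW => ?_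
  obtain ⟨w⟩ := hW
  obtain ⟨Z, -, ⟨k⟩, ⟨s⟩⟩ := X.exists_galois_over_hom_hom (Over.mk w) (Over.mk p)
  exact ⟨Z.left, ⟨s.left⟩, k.left, epi_of_hom _⟩

/-- ★ **Invariance along a cover**: for every morphism `p : 𝕏' → 𝕏` of `HolRS`, «objects mapping to `𝕏`» is id-rigid
iff «objects mapping to `𝕏'`» is (up: Galois descent, `isIdRigid_mapsTo_of_hom`; down: the previous theorem).
[cite: MochizukiAbsTopIII2015, Proposition 4.2 (i) p.106] -/
theorem isIdRigid_mapsTo_iff_of_hom {X X' : HolRS} (p : X' ⟶ X) :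
    IsIdRigid (ObjectProperty.FullSubcategory fun Y : HolRS => Nonempty (Y ⟶ X)) ↔
      IsIdRigid (ObjectProperty.FullSubcategory fun Y : HolRS => Nonempty (Y ⟶ X')) :=
  ⟨isIdRigid_mapsTo_of_hom p, isIdRigid_mapsTo_of_hom_of_isIdRigid p⟩

/-- **Commensurability invariance, common cover**: if `ℤ` maps to both `𝕏₁` and `𝕏₂`, then «mapsTo `𝕏₁`» is
id-rigid iff «mapsTo `𝕏₂`» is. [cite: MochizukiAbsTopIII2015, Proposition 4.2 (i) p.106] -/
theorem isIdRigid_mapsTo_iff_of_common_cover {X₁ X₂ Z : HolRS} (p₁ : Z ⟶ X₁) (p₂ : Z ⟶ X₂) :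
    IsIdRigid (ObjectProperty.FullSubcategory fun Y : HolRS => Nonempty (Y ⟶ X₁)) ↔
      IsIdRigid (ObjectProperty.FullSubcategory fun Y : HolRS => Nonempty (Y ⟶ X₂)) :=
  (isIdRigid_mapsTo_iff_of_hom p₁).trans (isIdRigid_mapsTo_iff_of_hom p₂).symm

/-- **Commensurability invariance, common quotient**: if `𝕏₁` and `𝕏₂` both map to `ℤ`, then «mapsTo `𝕏₁`» is
id-rigid iff «mapsTo `𝕏₂`» is. [cite: MochizukiAbsTopIII2015, Proposition 4.2 (i) p.106] -/
theorem isIdRigid_mapsTo_iff_of_common_quotient {X₁ X₂ Z : HolRS} (q₁ : X₁ ⟶ Z) (q₂ : X₂ ⟶ Z) :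
    IsIdRigid (ObjectProperty.FullSubcategory fun Y : HolRS => Nonempty (Y ⟶ X₁)) ↔
      IsIdRigid (ObjectProperty.FullSubcategory fun Y : HolRS => Nonempty (Y ⟶ X₂)) :=
  (isIdRigid_mapsTo_iff_of_hom q₁).symm.trans (isIdRigid_mapsTo_iff_of_hom q₂)

/-! ### §2 Consequences with ZERO hypotheses: every `𝕏` commensurable with a curve of type `(0, r ≥ 3)` or
`(1, r ≥ 1)` -/

/-- ★★ Every `𝕏` admitting a common finite étale cover with `ℂ ∖ F` (`F` finite, `|F| ≥ 2`) — e.g. every free finite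
quotient of a finite étale cover of the tripod — has «objects of `EA` mapping to `𝕏`» id-rigid.
[cite: MochizukiAbsTopIII2015, Proposition 4.2 (i) p.106] -/
theorem isIdRigid_mapsTo_of_commensurable_planeComplFinite {F : Set ℂ} (hF : F.Finite) {p₁ p₂ : ℂ}
    (hp₁ : p₁ ∈ F) (hp₂ : p₂ ∈ F) (hp : p₁ ≠ p₂) {X Z : HolRS} (p : Z ⟶ X) (q : Z ⟶ planeComplFinite F hF) :
    IsIdRigid (ObjectProperty.FullSubcategory fun Y : HolRS => Nonempty (Y ⟶ X)) :=
  (isIdRigid_mapsTo_iff_of_common_cover p q).2 (isIdRigid_mapsTo_planeComplFinite hF hp₁ hp₂ hp)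

/-- ★★ Every `𝕏` admitting a common finite étale cover with a complex torus minus a non-empty finite set has
«objects of `EA` mapping to `𝕏`» id-rigid. [cite: MochizukiAbsTopIII2015, Proposition 4.2 (i) p.106] -/
theorem isIdRigid_mapsTo_of_commensurable_complexTorus_compl_finite (Φ : (Fin 2 → ℝ) ≃L[ℝ] ℂ)
    {S : Set (ComplexTorus Φ)} (hS : S.Finite) (hne : S.Nonempty) {X Z : HolRS} (p : Z ⟶ X)
    (q : Z ⟶ ofOpens (M := ComplexTorus Φ) ⟨Sᶜ, hS.isClosed.isOpen_compl⟩
      (isConnected_complexTorus_compl_finite Φ hS hne)) :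
    IsIdRigid (ObjectProperty.FullSubcategory fun Y : HolRS => Nonempty (Y ⟶ X)) :=
  (isIdRigid_mapsTo_iff_of_common_cover p q).2 (isIdRigid_mapsTo_complexTorus_compl_finite Φ hS hne)

/-- ★★ Every `𝕏` admitting a common finite étale cover with a once-punctured elliptic curve has «objects of `EA`
mapping to `𝕏`» id-rigid. [cite: MochizukiAbsTopIII2015, Proposition 4.2 (i) p.106] -/
theorem isIdRigid_mapsTo_of_commensurable_of_isPuncturedEllipticCurve {X X₀ Z : HolRS} (p : Z ⟶ X)
    (q : Z ⟶ X₀) (hX₀ : TorsionPointsDenseUniqueGroupLaw.IsPuncturedEllipticCurve X₀.carrier) :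
    IsIdRigid (ObjectProperty.FullSubcategory fun Y : HolRS => Nonempty (Y ⟶ X)) :=
  (isIdRigid_mapsTo_iff_of_common_cover p q).2 (X₀.isIdRigid_mapsTo_of_isPuncturedEllipticCurve hX₀)

/-- [AbsTopIII] Cor 4.5 (i)–(v) over `EA^hol_RS(Q_𝕏)` for every `𝕏` commensurable with a once-punctured elliptic curve.
[cite: MochizukiAbsTopIII2015, Corollary 4.5 pp.107–109] -/
theorem cor_4_5_geometric_mapsTo_of_commensurable_of_isPuncturedEllipticCurve {X X₀ Z : HolRS} (p : Z ⟶ X)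
    (q : Z ⟶ X₀) (hX₀ : TorsionPointsDenseUniqueGroupLaw.IsPuncturedEllipticCurve X₀.carrier) :
    AbsTopIII.Cor_4_5
      (archLogFrobeniusData (geometricAutHolFieldFunctor (fun Y : HolRS => Nonempty (Y ⟶ X))))
      (archTelecoreData (geometricAutHolFieldFunctor (fun Y : HolRS => Nonempty (Y ⟶ X)))) :=
  cor_4_5_geometric _ ⟨X, ⟨𝟙 X⟩⟩ (isIdRigid_mapsTo_of_commensurable_of_isPuncturedEllipticCurve p q hX₀)

end HolRS

end Literature.AnabelianGeometry.AbsoluteAnabelian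

end
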